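import Summits.CriticalPhenomena.PercolationContinuityZ3.Theorems.SoloInformedSurfaceTensionVanishes
import Literature.Probability.Percolation.UniquenessZone
import Literature.Probability.Percolation.HalfSpaceBGN
import HarnessLib

/-!
# The surface tension vanishes CONTINUOUSLY at `p_c(ℤ^d)` (portrait item S15, second half)

Solo seat `solo-CriticalPhenomena-informed`. `SoloInformedSurfaceTensionVanishes` bounds the
surface-order decay rate of `P_p(Λ(n) ↮ ∞)` by `C_d |log(1-p)| θ_ℍ(p)` and deduces
`P_{p_c}(Λ(n) ↮ ∞) ≥ exp(-δ n^{d-1})` from `θ_ℍ(p_c) = 0` (BGN). Here we add the missing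
continuity statement: `θ_ℍ` is UPPER SEMICONTINUOUS (`theta_halfSpace_upperSemicontinuous`: it is
the infimum over `K` of the probabilities of the LOCAL events `halfBoxArm d K` = "the origin is
joined to `∂ⁱⁿΛ(K)` by an open path inside `ℍ ∩ Λ(K)`", each continuous in `p`), hence
`θ_ℍ(p) → 0` as `p → p_c` (`tendsto_theta_halfSpace_criticalProbI`), and therefore

* `surfaceTension_tendsto_zero` — for `d ≥ 2` and every `δ > 0`: for all `p` in a neighbourhood
  of `p_c(ℤ^d)`, eventually in `n`, `P_p(Λ(n) ↮ ∞) ≥ exp(-δ n^{d-1})`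
  (`surfaceTension_tendsto_zero_three`: `d = 3`, `n²`).

So the surface tension `σ(p) = limsup_n -n^{-(d-1)} log P_p(Λ(n) ↮ ∞)`, positive for every
`p > p_c` (Duminil-Copin–et-al. 2026, arXiv:2603.03257, Thm 2), tends to `0 = σ(p_c)` as
`p ↓ p_c` UNCONDITIONALLY: if `θ` jumped at `p_c(ℤ³)` the transition would be "weakly first
order" — a discontinuous order parameter with continuously vanishing surface tension.
(`paper/sharpest-statement.md` S15; in the Ising model positivity of the surface tension is
equivalent to long-range order, Lebowitz–Pfister 1981.) [folklore]
-/

noncomputable section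

namespace Summit.CriticalPhenomena.PercolationContinuityZ3.Theorems

open MeasureTheory ProbabilityTheory Filter Topology
open Literature.Probability.Percolation Literature.Probability.LatticeModels
open Literature.Probability.Percolation.CerfDembinVanishing
open scoped ENNReal

namespace SurfaceTension

variable {d : ℕ}

/-! ## The local half-space arm events -/

/-- `L_K`: the origin is joined to a site of the inner boundary of `Λ(K)` by an open lattice path
inside `ℍ ∩ Λ(K)`. -/
def halfBoxArm (d : ℕ) [NeZero d] (K : ℕ) : Set (BondConfig (Site d)) :=
  ⋃ b ∈ innerBoundary (zdGraph d) (box d K),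
    openConnVia (withinGraph (zdGraph d) (halfSpace d ∩ ↑(box d K))) 0 b

/-- Membership in `L_K`, unfolded. -/
theorem mem_halfBoxArm_iff [NeZero d] {K : ℕ} {ω : BondConfig (Site d)} :
    ω ∈ halfBoxArm d K ↔ ∃ b ∈ innerBoundary (zdGraph d) (box d K),
      (openGraph ω ⊓ withinGraph (zdGraph d) (halfSpace d ∩ ↑(box d K))).Reachable 0 b := by
  simp only [halfBoxArm, Set.mem_iUnion, exists_prop, openConnVia, Set.mem_setOf_eq,
    mem_openClusterIn_iff]

/-- `L_K` is measurable. -/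
theorem measurableSet_halfBoxArm [NeZero d] (K : ℕ) : MeasurableSet (halfBoxArm d K) :=
  MeasurableSet.biUnion (Set.to_countable _) fun b _ => measurableSet_openConnVia _ 0 b

/-- `L_K` is determined by the pairs inside `Λ(K)`. -/
theorem determinedBy_halfBoxArm [NeZero d] (K : ℕ) :
    DeterminedBy (halfBoxArm d K) (↑((box d K).sym2) : Set (Sym2 (Site d))) := by
  set W := withinGraph (zdGraph d) (halfSpace d ∩ ↑(box d K)) with hW
  have hsub : W.edgeSet ⊆ (↑((box d K).sym2) : Set (Sym2 (Site d))) := by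
    intro e
    induction e using Sym2.ind with
    | h a c =>
      intro he
      rw [SimpleGraph.mem_edgeSet, hW, withinGraph_adj] at he
      exact Finset.mem_coe.2 (Finset.mk_mem_sym2_iff.2 ⟨he.2.1.2, he.2.2.2⟩)
  rw [determinedBy_iff]
  intro ω ω' h
  have h' : ω ∩ W.edgeSet = ω' ∩ W.edgeSet := by
    have := congrArg (fun s => s ∩ W.edgeSet) h
    simpa only [Set.inter_assoc, Set.inter_eq_right.2 hsub] using this
  simp only [halfBoxArm, Set.mem_iUnion, exists_prop, openConnVia, Set.mem_setOf_eq]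
  rw [← openClusterIn_inter_edgeSet (ω := ω), h', openClusterIn_inter_edgeSet]

/-- `p ↦ P_p(L_K)` is continuous. -/
theorem continuous_real_halfBoxArm [NeZero d] (K : ℕ) :
    Continuous fun p : unitInterval => (bondPercolation (zdGraph d) p).real (halfBoxArm d K) :=
  continuous_bondPercolation_real_of_determinedBy (zdGraph d) (determinedBy_halfBoxArm K)

/-- Exit lemma for half-space paths: an open lattice path from `0` inside `T ⊆ ℍ` to a site outside
`Λ(K)` puts `ω` in `L_K`. -/
theorem mem_halfBoxArm_of_reachable [NeZero d] {K : ℕ} {ω : BondConfig (Site d)} {T : Set (Site d)}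
    (hT : T ⊆ halfSpace d) {z : Site d} (hz : z ∉ box d K)
    (hr : (openGraph ω ⊓ withinGraph (zdGraph d) T).Reachable 0 z) : ω ∈ halfBoxArm d K := by
  obtain ⟨w⟩ := hr
  have hH : openGraph ω ⊓ withinGraph (zdGraph d) T ≤ zdGraph d := fun a c h => by
    rw [SimpleGraph.inf_adj, withinGraph_adj] at h
    exact h.2.1
  obtain ⟨b, c, hb, hc, hbc, hr'⟩ := exists_exit_of_walk hH (↑(box d K) : Set (Site d)) w
    (Finset.mem_coe.2 (zero_mem_box d K)) (fun h => hz (Finset.mem_coe.1 h))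
  refine mem_halfBoxArm_iff.2 ⟨b, mem_innerBoundary_iff.2
    ⟨Finset.mem_coe.1 hb, c, fun h => hc (Finset.mem_coe.2 h), hH hbc⟩, hr'.mono ?_⟩
  intro a e h
  simp only [SimpleGraph.inf_adj, withinGraph_adj] at h ⊢
  exact ⟨h.1.1, h.2.1, ⟨hT h.1.2.2.1, h.2.2.1⟩, hT h.1.2.2.2, h.2.2.2⟩

/-- `L_{K+1} ⊆ L_K`. -/
theorem halfBoxArm_succ_subset [NeZero d] (K : ℕ) : halfBoxArm d (K + 1) ⊆ halfBoxArm d K := by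
  intro ω hω
  obtain ⟨b, hb, hr⟩ := mem_halfBoxArm_iff.1 hω
  exact mem_halfBoxArm_of_reachable Set.inter_subset_left
    (notMem_box_of_mem_innerBoundary_succ hb) hr

/-- `K ↦ L_K` is antitone. -/
theorem antitone_halfBoxArm [NeZero d] : Antitone fun K => halfBoxArm d K :=
  antitone_nat_of_succ_le halfBoxArm_succ_subset

/-- Percolation of the origin inside `ℍ` implies every `L_K`. -/
theorem percolatesVia_halfSpace_subset_halfBoxArm [NeZero d] (K : ℕ) :
    percolatesVia (withinGraph (zdGraph d) (halfSpace d)) (0 : Site d) ⊆ halfBoxArm d K := by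
  intro ω hω
  obtain ⟨z, hz, hzK⟩ := (hω : (openClusterIn _ ω 0).Infinite).exists_notMem_finset (box d K)
  exact mem_halfBoxArm_of_reachable subset_rfl hzK (mem_openClusterIn_iff.1 hz)

/-- Conversely, `⋂_K L_K` forces the `ℍ`-cluster of the origin to be infinite. -/
theorem iInter_halfBoxArm_subset [NeZero d] :
    (⋂ K, halfBoxArm d K) ⊆ percolatesVia (withinGraph (zdGraph d) (halfSpace d)) (0 : Site d) := by
  intro ω hω
  rw [Set.mem_iInter] at hω
  -- for every `K` a site of `∂ⁱⁿΛ(K)` in the `ℍ`-cluster of `0`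
  have hmem : ∀ K, ∃ b ∈ innerBoundary (zdGraph d) (box d K),
      b ∈ openClusterIn (withinGraph (zdGraph d) (halfSpace d)) ω 0 := by
    intro K
    obtain ⟨b, hb, hr⟩ := mem_halfBoxArm_iff.1 (hω K)
    refine ⟨b, hb, mem_openClusterIn_iff.2 (hr.mono ?_)⟩
    intro a c h
    simp only [SimpleGraph.inf_adj, withinGraph_adj] at h ⊢
    exact ⟨h.1, h.2.1, h.2.2.1.1, h.2.2.2.1⟩
  by_contra hfin
  have hfin' : (openClusterIn (withinGraph (zdGraph d) (halfSpace d)) ω 0).Finite :=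
    Set.not_infinite.1 hfin
  obtain ⟨R, hR⟩ := BGNd.exists_subset_box hfin'.toFinset
  obtain ⟨b, hb, hbC⟩ := hmem (R + 1)
  exact notMem_box_of_mem_innerBoundary_succ hb (hR (hfin'.mem_toFinset.2 hbC))

/-! ## Upper semicontinuity of `θ_ℍ` -/

/-- `θ_ℍ(p) ≤ P_p(L_K)` for every `K`. -/
theorem theta_halfSpace_le_real_halfBoxArm [NeZero d] (p : unitInterval) (K : ℕ) :
    theta (halfSpaceGraph d) (halfSpaceOrigin d) p ≤
      (bondPercolation (zdGraph d) p).real (halfBoxArm d K) := by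
  rw [show theta (halfSpaceGraph d) (halfSpaceOrigin d) p =
      (bondPercolation (zdGraph d) p).real (percolatesVia (withinGraph (zdGraph d) (halfSpace d)) 0)
    from theta_induce_eq_real_percolatesVia (zdGraph d) (halfSpace d) (0 : Site d)
      (zero_mem_halfSpace d) p]
  exact measureReal_mono (percolatesVia_halfSpace_subset_halfBoxArm K) (measure_ne_top _ _)

/-- `P_p(L_K) ↓` a limit `≤ θ_ℍ(p)`: for every `η > 0` some `L_K` has probability
`< θ_ℍ(p) + η`. -/
theorem exists_real_halfBoxArm_lt [NeZero d] (p : unitInterval) {η : ℝ} (hη : 0 < η) :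
    ∃ K, (bondPercolation (zdGraph d) p).real (halfBoxArm d K) <
      theta (halfSpaceGraph d) (halfSpaceOrigin d) p + η := by
  set μ := bondPercolation (zdGraph d) p with hμ
  have hreal : theta (halfSpaceGraph d) (halfSpaceOrigin d) p =
      μ.real (percolatesVia (withinGraph (zdGraph d) (halfSpace d)) 0) :=
    theta_induce_eq_real_percolatesVia (zdGraph d) (halfSpace d) (0 : Site d) (zero_mem_halfSpace d) p
  have hlim := tendsto_measure_iInter_atTop (μ := μ)
    (fun K => (measurableSet_halfBoxArm (d := d) K).nullMeasurableSet) antitone_halfBoxArm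
    ⟨0, measure_ne_top _ _⟩
  have hlim' : Tendsto (fun K => μ.real (halfBoxArm d K)) atTop
      (𝓝 (μ.real (⋂ K, halfBoxArm d K))) :=
    (ENNReal.tendsto_toReal (measure_ne_top _ _)).comp hlim
  have hle : μ.real (⋂ K, halfBoxArm d K) ≤ theta (halfSpaceGraph d) (halfSpaceOrigin d) p := by
    rw [hreal]; exact measureReal_mono iInter_halfBoxArm_subset (measure_ne_top _ _)
  exact ((tendsto_order.1 hlim').2 _ (show μ.real (⋂ K, halfBoxArm d K) <
    theta (halfSpaceGraph d) (halfSpaceOrigin d) p + η by linarith)).exists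

/-- **`θ_ℍ` is upper semicontinuous** (at every `p₀`): an infimum of continuous functions.
[folklore] -/
theorem theta_halfSpace_upperSemicontinuous [NeZero d] (p₀ : unitInterval) {η : ℝ} (hη : 0 < η) :
    ∀ᶠ p in 𝓝 p₀, theta (halfSpaceGraph d) (halfSpaceOrigin d) p <
      theta (halfSpaceGraph d) (halfSpaceOrigin d) p₀ + η := by
  obtain ⟨K, hK⟩ := exists_real_halfBoxArm_lt (d := d) p₀ hη
  have hcont := (continuous_real_halfBoxArm (d := d) K).continuousAt (x := p₀)
  filter_upwards [(tendsto_order.1 hcont).2 _ hK] with p hp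
  exact (theta_halfSpace_le_real_halfBoxArm p K).trans_lt hp

/-- **`θ_ℍ(p) → 0 = θ_ℍ(p_c)` as `p → p_c(ℤ^d)`**, `d ≥ 2` (upper semicontinuity and
Barsky–Grimmett–Newman). [folklore] -/
theorem tendsto_theta_halfSpace_criticalProbI [NeZero d] (hd : 2 ≤ d) :
    Tendsto (fun p => theta (halfSpaceGraph d) (halfSpaceOrigin d) p) (𝓝 (criticalProbI d))
      (𝓝 0) := by
  have h0 : theta (halfSpaceGraph d) (halfSpaceOrigin d) (criticalProbI d) = 0 :=
    BarskyGrimmettNewman1991_holds d hd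
  rw [Metric.tendsto_nhds]
  intro η hη
  filter_upwards [theta_halfSpace_upperSemicontinuous (d := d) (criticalProbI d) hη] with p hp
  rw [h0, zero_add] at hp
  have h0p : (0 : ℝ) ≤ theta (halfSpaceGraph d) (halfSpaceOrigin d) p := measureReal_nonneg
  rw [Real.dist_eq, sub_zero, abs_of_nonneg h0p]
  exact hp

/-! ## The surface tension tends to zero -/

/-- **The surface tension vanishes continuously at `p_c(ℤ^d)`**, `d ≥ 2`: for every `δ > 0`, for
all `p` in a neighbourhood of `p_c`, eventually in `n`, `P_p(Λ(n) ↮ ∞) ≥ exp(-δ n^{d-1})`.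
Unconditional (valid whether or not `θ(p_c) = 0`). [folklore] -/
theorem surfaceTension_tendsto_zero [NeZero d] (hd : 2 ≤ d) {δ : ℝ} (hδ : 0 < δ) :
    ∀ᶠ p : unitInterval in 𝓝 (criticalProbI d), ∀ᶠ n : ℕ in atTop,
      Real.exp (-δ * (n : ℝ) ^ (d - 1)) ≤ (bondPercolation (zdGraph d) p).real (boxToInfinity d n)ᶜ := by
  -- a neighbourhood of `p_c` bounded away from `1`
  have hpc1 : (criticalProbI d : ℝ) < 1 := by rw [coe_criticalProbI]; exact criticalProb_zd_lt_one hd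
  set p₁ : ℝ := ((criticalProbI d : ℝ) + 1) / 2 with hp₁
  have hp₁1 : p₁ < 1 := by rw [hp₁]; linarith
  have hpcp₁ : (criticalProbI d : ℝ) < p₁ := by rw [hp₁]; linarith
  have hnear : ∀ᶠ p : unitInterval in 𝓝 (criticalProbI d), (p : ℝ) < p₁ :=
    (continuous_subtype_val.tendsto (criticalProbI d)).eventually (Iio_mem_nhds hpcp₁)
  -- the constants
  set C : ℝ := 8 * (d : ℝ) ^ 2 * 3 ^ (d - 1) with hC
  have hC0 : 0 < C := by rw [hC]; positivity
  set Λ₁ : ℝ := -Real.log (1 - p₁) with hΛ₁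
  have hΛ₁0 : 0 ≤ Λ₁ := by
    rw [hΛ₁, neg_nonneg]; exact Real.log_nonpos (by linarith) (by linarith [hpcp₁, (criticalProbI d).2.1])
  set η : ℝ := δ / (2 * C * (Λ₁ + 1)) with hη
  have hη0 : 0 < η := by rw [hη]; positivity
  have hsmall := (Metric.tendsto_nhds.1 (tendsto_theta_halfSpace_criticalProbI (d := d) hd)) η hη0
  filter_upwards [hnear, hsmall] with p hp hθabs
  have hθ : theta (halfSpaceGraph d) (halfSpaceOrigin d) p < η := by
    rw [Real.dist_eq, sub_zero] at hθabs
    exact (abs_lt.1 hθabs).2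
  have hp1 : (p : ℝ) < 1 := hp.trans hp₁1
  have hev := eventually_exp_le_real_compl_boxToInfinity (d := d) hd p hp1 (half_pos hδ)
  filter_upwards [hev] with n hn
  refine le_trans ?_ hn
  -- compare the exponents: `C |log(1-p)| θ_ℍ(p) + δ/2 ≤ δ`
  have hlog : -Real.log (1 - (p : ℝ)) ≤ Λ₁ := by
    rw [hΛ₁, neg_le_neg_iff]
    exact Real.log_le_log (by linarith) (by linarith)
  have hlog0 : 0 ≤ -Real.log (1 - (p : ℝ)) := by
    rw [neg_nonneg]; exact Real.log_nonpos (by linarith [p.2.1]) (by linarith [p.2.1])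
  have hθ0 : 0 ≤ theta (halfSpaceGraph d) (halfSpaceOrigin d) p := measureReal_nonneg
  have h1 : C * (-Real.log (1 - (p : ℝ))) * theta (halfSpaceGraph d) (halfSpaceOrigin d) p ≤
      C * Λ₁ * η := by
    have := mul_le_mul (mul_le_mul_of_nonneg_left hlog hC0.le) hθ.le hθ0 (by positivity)
    exact this
  have h2 : C * Λ₁ * η ≤ δ / 2 := by
    rw [hη, show C * Λ₁ * (δ / (2 * C * (Λ₁ + 1))) = (δ / 2) * (Λ₁ / (Λ₁ + 1)) by
      field_simp]
    have : Λ₁ / (Λ₁ + 1) ≤ 1 := by rw [div_le_one (by positivity)]; linarith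
    calc (δ / 2) * (Λ₁ / (Λ₁ + 1)) ≤ (δ / 2) * 1 := by
          exact mul_le_mul_of_nonneg_left this (by positivity)
      _ = δ / 2 := mul_one _
  have hnn : 0 ≤ (n : ℝ) ^ (d - 1) := by positivity
  rw [Real.exp_le_exp]
  have h3 : (C * (-Real.log (1 - (p : ℝ))) * theta (halfSpaceGraph d) (halfSpaceOrigin d) p + δ / 2) *
      (n : ℝ) ^ (d - 1) ≤ δ * (n : ℝ) ^ (d - 1) :=
    mul_le_mul_of_nonneg_right (by linarith) hnn
  linarith

/-- The case `d = 3`: for every `δ > 0`, near `p_c(ℤ³)`, eventually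
`P_p(Λ(n) ↮ ∞) ≥ exp(-δ n²)`. [folklore] -/
theorem surfaceTension_tendsto_zero_three {δ : ℝ} (hδ : 0 < δ) :
    ∀ᶠ p : unitInterval in 𝓝 (criticalProbI 3), ∀ᶠ n : ℕ in atTop,
      Real.exp (-δ * (n : ℝ) ^ 2) ≤ (bondPercolation (zdGraph 3) p).real (boxToInfinity 3 n)ᶜ := by
  simpa using surfaceTension_tendsto_zero (d := 3) (by norm_num) hδ

end SurfaceTension

end Summit.CriticalPhenomena.PercolationContinuityZ3.Theorems

end
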